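/-
Route `LevelGradedCohnUmans`, crux `SubgroupIdentityDesigns` (stmt-MatrixMultiplication-14079).
Cell B2b-5 (`b2b-lgcu-borel`, gen 6).  HONEST FRAMING: the VALUE here is a THEOREM / a DECIDABLE
VERDICT / a CERTIFICATE — NOT summit progress.  This file proves that the crux holds in the LARGE-`ε` regime (`ε ≥ 7`)
by explicit Borel families in `GL₂(𝔽_p)`; it says nothing about the small-`ε` regime that would
bear on `ω`.
-/
import Mathlib
import Summits.MatrixMultiplication.MatrixMultiplication.Theorems.SubgroupIdentityDesigns.Negative.BorelFamilyF
import Summits.MatrixMultiplication.MatrixMultiplication.Theorems.SubgroupIdentityDesigns.Negative.BorelDiagonalFamily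
import Summits.MatrixMultiplication.MatrixMultiplication.Theorems.LevelGradedCohnUmansLevelOneLink

/-!
# `SubgroupIdentityDesigns`: the large-`ε` regime is a theorem

Write `SIDBody ε` for the body of the crux `SubgroupIdentityDesigns` at accuracy `ε` (verbatim),
so that `SubgroupIdentityDesigns ↔ ∀ ε > 0, SIDBody ε` holds by `Iff.rfl`
(`subgroupIdentityDesigns_iff_body`).  With the level-one budget bound
`∑_{Irr ∩ F₁} χ(1)^s ≤ (p+1)^{s-1} p²` (`LevelOneLink.levelOne_budget_le`):

* the Borel family `F` (`BorelFamilyF.borelFamily`, volume `2(p-1)³`) gives `SIDBody ε` whenever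
  `(p+1)^{1+ε} p² < (2(p-1)³)^{(2+ε)/3}` (`sidBody_of_budget`); at `p = 43`, `t₀ = 4` this holds
  for all `ε ≥ 19` (`numeric_43`, `sidBody_of_ge_nineteen`; exact threshold `ε₀(43) ≈ 18.21`);
* the diagonal family (`BorelDiagonalFamily.diagFamily`, volume `(p-1)²|R₂||R₃|`) gives
  `SIDBody ε` under the analogous inequality (`sidBody_of_diag_budget`); at `p = 31`, `R₂ = μ₆`,
  `R₃ = μ₁₅`, `c = 19`, missing unipotent `u₁₂` (both arithmetic conditions by `decide`), the
  volume is `81000 = 3 · 30³` and the inequality holds for all `ε ≥ 10` (`numeric_31`,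
  `sidBody_of_ge_ten`; exact threshold `ε₀ ≈ 9.24`); at `p = 241`, `R₂ = μ₂₄ = ⟨2⟩`,
  `R₃ = μ₈₀ = ⟨17⟩`, `c = 217`, missing `u₂₄` (conditions by `decide` on the `24 · 80` exponent
  pairs), the volume is `110592000 = 8 · 240³` and the inequality holds for all `ε ≥ 7`
  (`numeric_241`, `sidBody_of_ge_seven`; exact threshold `ε₀ ≈ 6.0025`, the smallest value found
  in the whole Borel census of this cell, `p < 2000`).

Consequently (`subgroupIdentityDesigns_iff_small_eps`)

  `SubgroupIdentityDesigns ↔ ∀ ε, 0 < ε → ε < 7 → SIDBody ε`: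

the open content of the crux is exactly its small-`ε` regime (Borel triples can never reach
`ε < 1`, since their volume is at most `(p-1)⁴`).  [folklore numerics; families: this cell]
-/

noncomputable section

open scoped BigOperators Classical
open Summit.MatrixMultiplication.MatrixMultiplication.Theorems.LieRankDesigns.Negative

namespace Summit.MatrixMultiplication.MatrixMultiplication.Theorems.SubgroupIdentityDesigns.Negative

variable {p : ℕ} [Fact p.Prime]

/-! ## The crux body, and family `F` at `p = 43` -/

/-- The body of `SubgroupIdentityDesigns` at a fixed exponent `ε` (verbatim). -/
def SIDBody (ε : ℝ) : Prop :=
  ∃ (p : ℕ) (_ : Fact p.Prime) (m k : ℕ)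
    (H₁ H₂ H₃ : Subgroup (Matrix.GeneralLinearGroup (Fin m) (ZMod p))),
    Literature.Barriers.MatrixMultiplication.SubgroupTPP H₁ H₂ H₃ ∧
    (∃ c : Matrix (Fin m) (Fin m) (ZMod p) → ℂ, (∀ M, k < M.rank → c M = 0) ∧
      (∑ M : Matrix (Fin m) (Fin m) (ZMod p), c M * ZMod.stdAddChar (Matrix.trace
        (M * ((1 : Matrix.GeneralLinearGroup (Fin m) (ZMod p)) :
          Matrix (Fin m) (Fin m) (ZMod p))))) = 1 ∧
      ∀ a ∈ H₁, ∀ b ∈ H₂, ∀ g ∈ H₃, a * b * g ≠ 1 →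
        (∑ M : Matrix (Fin m) (Fin m) (ZMod p), c M * ZMod.stdAddChar (Matrix.trace
          (M * ((a * b * g : Matrix.GeneralLinearGroup (Fin m) (ZMod p)) :
            Matrix (Fin m) (Fin m) (ZMod p))))) = 0) ∧
    (∑ᶠ χ ∈ Literature.RepresentationTheory.FiniteGroups.irrChars
        (Matrix.GeneralLinearGroup (Fin m) (ZMod p)) ∩
        {f | ∃ c : Matrix (Fin m) (Fin m) (ZMod p) → ℂ, (∀ M, k < M.rank → c M = 0) ∧
          ∀ g : Matrix.GeneralLinearGroup (Fin m) (ZMod p), f g =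
            ∑ M : Matrix (Fin m) (Fin m) (ZMod p), c M * ZMod.stdAddChar
              (Matrix.trace (M * (g : Matrix (Fin m) (Fin m) (ZMod p))))},
      (χ 1).re ^ (2 + ε)) <
      ((Nat.card H₁ * Nat.card H₂ * Nat.card H₃ : ℕ) : ℝ) ^ ((2 + ε) / 3)

/-- The crux is `∀ ε > 0, SIDBody ε` (definitional). -/
theorem subgroupIdentityDesigns_iff_body :
    Summit.MatrixMultiplication.MatrixMultiplication.Theses.LevelGradedCohnUmans.SubgroupIdentityDesigns
      ↔ ∀ ε : ℝ, 0 < ε → SIDBody ε :=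
  Iff.rfl

/-- **Budget form**: the family `F` at `p` settles the crux body at every `ε ≥ -1` with
`(p+1)^{1+ε} p² < (2(p-1)³)^{(2+ε)/3}`. -/
theorem sidBody_of_budget (hneg : ¬IsSquare (-1 : ZMod p)) (htwo : ¬IsSquare (2 : ZMod p))
    (t₀ : ZMod p) (ht₁ : ¬IsSquare (t₀ ^ 2 - 4)) (ht₂ : ¬IsSquare (t₀ ^ 2 + 4))
    (ε : ℝ) (hε : -1 ≤ ε)
    (hbud : ((p : ℝ) + 1) ^ (1 + ε) * (p : ℝ) ^ 2 <
      ((2 * (p - 1) ^ 3 : ℕ) : ℝ) ^ ((2 + ε) / 3)) :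
    SIDBody ε := by
  obtain ⟨H₁, H₂, H₃, htpp, hdes, hcard⟩ := borelFamily hneg htwo t₀ ht₁ ht₂
  refine ⟨p, inferInstance, 2, 1, H₁, H₂, H₃, htpp, hdes, ?_⟩
  rw [hcard]
  calc _ ≤ ((p : ℝ) + 1) ^ ((2 + ε) - 1) * (p : ℝ) ^ 2 :=
        LevelOneLink.levelOne_budget_le p (2 + ε) (by linarith)
    _ = ((p : ℝ) + 1) ^ (1 + ε) * (p : ℝ) ^ 2 := by
        congr 1; ring_nf
    _ < _ := hbud

/-- `43` is prime. -/
instance fact_prime_43 : Fact (Nat.Prime 43) := ⟨by norm_num⟩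

/-- The numerical inequality at `p = 43`: `44^{1+ε} · 43² < 148176^{(2+ε)/3}` for `ε ≥ 19`
(`148176 = 2 · 42³`; after cubing, `44^{60} 43^6 < 148176^{21}` and `44³ ≤ 148176`). -/
theorem numeric_43 (ε : ℝ) (hε : 19 ≤ ε) :
    (44 : ℝ) ^ (1 + ε) * (43 : ℝ) ^ 2 < (148176 : ℝ) ^ ((2 + ε) / 3) := by
  have hA : 0 ≤ (44 : ℝ) ^ (1 + ε) * (43 : ℝ) ^ 2 := by positivity
  have hB : 0 ≤ (148176 : ℝ) ^ ((2 + ε) / 3) := by positivity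
  rw [← pow_lt_pow_iff_left₀ hA hB (three_ne_zero)]
  obtain ⟨δ, hδ, rfl⟩ : ∃ δ : ℝ, 0 ≤ δ ∧ ε = 19 + δ := ⟨ε - 19, by linarith, by ring⟩
  have e1 : ((148176 : ℝ) ^ ((2 + (19 + δ)) / 3)) ^ 3 =
      (148176 : ℝ) ^ (21 : ℕ) * (148176 : ℝ) ^ δ := by
    rw [← Real.rpow_natCast ((148176 : ℝ) ^ ((2 + (19 + δ)) / 3)) 3,
      ← Real.rpow_mul (by norm_num), ← Real.rpow_natCast (148176 : ℝ) 21,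
      ← Real.rpow_add (by norm_num)]
    congr 1; push_cast; ring
  have e2 : ((44 : ℝ) ^ (1 + (19 + δ)) * (43 : ℝ) ^ 2) ^ 3 =
      (44 : ℝ) ^ (60 : ℕ) * (43 : ℝ) ^ 6 * ((44 : ℝ) ^ (3 : ℕ)) ^ δ := by
    have hexp : (1 + (19 + δ)) * ((3 : ℕ) : ℝ) = ((60 : ℕ) : ℝ) + ((3 : ℕ) : ℝ) * δ := by
      push_cast; ring
    rw [mul_pow, show ((43 : ℝ) ^ 2) ^ 3 = (43 : ℝ) ^ 6 by norm_num,
      ← Real.rpow_natCast ((44 : ℝ) ^ (1 + (19 + δ))) 3,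
      ← Real.rpow_mul (by norm_num), hexp, Real.rpow_add (by norm_num), Real.rpow_natCast,
      Real.rpow_mul (by norm_num), Real.rpow_natCast]
    ring
  rw [e1, e2]
  have h3 : ((44 : ℝ) ^ (3 : ℕ)) ^ δ ≤ (148176 : ℝ) ^ δ :=
    Real.rpow_le_rpow (by positivity) (by norm_num) hδ
  have hpos : 0 < ((44 : ℝ) ^ (3 : ℕ)) ^ δ := Real.rpow_pos_of_pos (by positivity) δ
  calc (44 : ℝ) ^ (60 : ℕ) * (43 : ℝ) ^ 6 * ((44 : ℝ) ^ (3 : ℕ)) ^ δ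
      < (148176 : ℝ) ^ (21 : ℕ) * ((44 : ℝ) ^ (3 : ℕ)) ^ δ :=
        mul_lt_mul_of_pos_right (by norm_num) hpos
    _ ≤ (148176 : ℝ) ^ (21 : ℕ) * (148176 : ℝ) ^ δ :=
        mul_le_mul_of_nonneg_left h3 (by positivity)

/-- **Family `F` settles the crux body at every `ε ≥ 19`** (`p = 43`, `t₀ = 4`). -/
theorem sidBody_of_ge_nineteen (ε : ℝ) (hε : 19 ≤ ε) : SIDBody ε := by
  have hneg : ¬IsSquare (-1 : ZMod 43) := by
    rw [ZMod.exists_sq_eq_neg_one_iff]; decide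
  have htwo : ¬IsSquare (2 : ZMod 43) := by
    rw [ZMod.exists_sq_eq_two_iff (by decide)]; decide
  have ht₁ : ¬IsSquare ((4 : ZMod 43) ^ 2 - 4) := by decide
  have ht₂ : ¬IsSquare ((4 : ZMod 43) ^ 2 + 4) := by decide
  refine sidBody_of_budget (p := 43) hneg htwo 4 ht₁ ht₂ ε (by linarith) ?_
  have := numeric_43 ε hε
  push_cast
  norm_num at this ⊢
  exact this

/-! ## The diagonal family: budget form and the instance `p = 31` -/

/-- **Budget form** for the diagonal family. -/
theorem sidBody_of_diag_budget (R₂ R₃ : Subgroup (ZMod p)ˣ) (c y₀ : ZMod p) (hy₀ : y₀ ≠ 0)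
    (hT : ∀ y₂ ∈ R₂, ∀ y₃ ∈ R₃,
      c * ((y₃ : ZMod p) - 1) + ((y₂ : ZMod p) - 1) * y₃ = 0 → y₂ = 1 ∧ y₃ = 1)
    (hM : ∀ y₂ ∈ R₂, ∀ y₃ ∈ R₃, c * ((y₃ : ZMod p) - 1) + ((y₂ : ZMod p) - 1) * y₃ ≠ y₀)
    (ε : ℝ) (hε : -1 ≤ ε)
    (hbud : ((p : ℝ) + 1) ^ (1 + ε) * (p : ℝ) ^ 2 <
      (((p - 1) ^ 2 * Nat.card R₂ * Nat.card R₃ : ℕ) : ℝ) ^ ((2 + ε) / 3)) :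
    SIDBody ε := by
  obtain ⟨H₁, H₂, H₃, htpp, hdes, hcard⟩ := diagFamily R₂ R₃ c y₀ hy₀ hT hM
  refine ⟨p, inferInstance, 2, 1, H₁, H₂, H₃, htpp, hdes, ?_⟩
  rw [hcard]
  calc _ ≤ ((p : ℝ) + 1) ^ ((2 + ε) - 1) * (p : ℝ) ^ 2 :=
        LevelOneLink.levelOne_budget_le p (2 + ε) (by linarith)
    _ = ((p : ℝ) + 1) ^ (1 + ε) * (p : ℝ) ^ 2 := by
        congr 1; ring_nf
    _ < _ := hbud

/-- `31` is prime. -/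
instance fact_prime_31 : Fact (Nat.Prime 31) := ⟨by norm_num⟩

/-- `|μ₆(𝔽₃₁)| = 6` (`26` is a primitive sixth root of unity mod `31`). -/
theorem card_rootsOfUnity_six_31 : Nat.card (rootsOfUnity 6 (ZMod 31)) = 6 := by
  have h : IsPrimitiveRoot (26 : ZMod 31) 6 := by
    refine IsPrimitiveRoot.mk_of_lt 26 (by norm_num) (by decide) ?_
    intro l h0 hl
    interval_cases l <;> decide
  exact h.card_rootsOfUnity

/-- `|μ₁₅(𝔽₃₁)| = 15` (`9` is a primitive fifteenth root of unity mod `31`). -/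
theorem card_rootsOfUnity_fifteen_31 : Nat.card (rootsOfUnity 15 (ZMod 31)) = 15 := by
  have h : IsPrimitiveRoot (9 : ZMod 31) 15 := by
    refine IsPrimitiveRoot.mk_of_lt 9 (by norm_num) (by decide) ?_
    intro l h0 hl
    interval_cases l <;> decide
  exact h.card_rootsOfUnity

/-- The numerical inequality at `p = 31`: `32^{1+ε} · 31² < 81000^{(2+ε)/3}` for `ε ≥ 10`
(`81000 = 3 · 30³`; after cubing, `32^{33} 31^6 < 81000^{12}` and `32³ ≤ 81000`). -/
theorem numeric_31 (ε : ℝ) (hε : 10 ≤ ε) :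
    (32 : ℝ) ^ (1 + ε) * (31 : ℝ) ^ 2 < (81000 : ℝ) ^ ((2 + ε) / 3) := by
  have hA : 0 ≤ (32 : ℝ) ^ (1 + ε) * (31 : ℝ) ^ 2 := by positivity
  have hB : 0 ≤ (81000 : ℝ) ^ ((2 + ε) / 3) := by positivity
  rw [← pow_lt_pow_iff_left₀ hA hB (three_ne_zero)]
  obtain ⟨δ, hδ, rfl⟩ : ∃ δ : ℝ, 0 ≤ δ ∧ ε = 10 + δ := ⟨ε - 10, by linarith, by ring⟩
  have e1 : ((81000 : ℝ) ^ ((2 + (10 + δ)) / 3)) ^ 3 =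
      (81000 : ℝ) ^ (12 : ℕ) * (81000 : ℝ) ^ δ := by
    rw [← Real.rpow_natCast ((81000 : ℝ) ^ ((2 + (10 + δ)) / 3)) 3,
      ← Real.rpow_mul (by norm_num), ← Real.rpow_natCast (81000 : ℝ) 12,
      ← Real.rpow_add (by norm_num)]
    congr 1; push_cast; ring
  have e2 : ((32 : ℝ) ^ (1 + (10 + δ)) * (31 : ℝ) ^ 2) ^ 3 =
      (32 : ℝ) ^ (33 : ℕ) * (31 : ℝ) ^ 6 * ((32 : ℝ) ^ (3 : ℕ)) ^ δ := by
    have hexp : (1 + (10 + δ)) * ((3 : ℕ) : ℝ) = ((33 : ℕ) : ℝ) + ((3 : ℕ) : ℝ) * δ := by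
      push_cast; ring
    rw [mul_pow, show ((31 : ℝ) ^ 2) ^ 3 = (31 : ℝ) ^ 6 by norm_num,
      ← Real.rpow_natCast ((32 : ℝ) ^ (1 + (10 + δ))) 3,
      ← Real.rpow_mul (by norm_num), hexp, Real.rpow_add (by norm_num), Real.rpow_natCast,
      Real.rpow_mul (by norm_num), Real.rpow_natCast]
    ring
  rw [e1, e2]
  have h3 : ((32 : ℝ) ^ (3 : ℕ)) ^ δ ≤ (81000 : ℝ) ^ δ :=
    Real.rpow_le_rpow (by positivity) (by norm_num) hδ
  have hpos : 0 < ((32 : ℝ) ^ (3 : ℕ)) ^ δ := Real.rpow_pos_of_pos (by positivity) δ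
  calc (32 : ℝ) ^ (33 : ℕ) * (31 : ℝ) ^ 6 * ((32 : ℝ) ^ (3 : ℕ)) ^ δ
      < (81000 : ℝ) ^ (12 : ℕ) * ((32 : ℝ) ^ (3 : ℕ)) ^ δ :=
        mul_lt_mul_of_pos_right (by norm_num) hpos
    _ ≤ (81000 : ℝ) ^ (12 : ℕ) * (81000 : ℝ) ^ δ :=
        mul_le_mul_of_nonneg_left h3 (by positivity)

/-- **The crux body holds at every `ε ≥ 10`**: the diagonal family at `p = 31` with
`R₂ = μ₆`, `R₃ = μ₁₅`, `c = 19`, missing unipotent `u₁₂`, volume `81000 = 3 · 30³`. -/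
theorem sidBody_of_ge_ten (ε : ℝ) (hε : 10 ≤ ε) : SIDBody ε := by
  have keyT : ∀ a b : ZMod 31, a ^ 6 = 1 → b ^ 15 = 1 →
      (19 : ZMod 31) * (b - 1) + (a - 1) * b = 0 → a = 1 ∧ b = 1 := by
    decide
  have keyM : ∀ a b : ZMod 31, a ^ 6 = 1 → b ^ 15 = 1 →
      (19 : ZMod 31) * (b - 1) + (a - 1) * b ≠ 12 := by
    decide
  have hT : ∀ y₂ ∈ rootsOfUnity 6 (ZMod 31), ∀ y₃ ∈ rootsOfUnity 15 (ZMod 31),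
      (19 : ZMod 31) * ((y₃ : ZMod 31) - 1) + ((y₂ : ZMod 31) - 1) * y₃ = 0 →
        y₂ = 1 ∧ y₃ = 1 := by
    intro y₂ h₂ y₃ h₃ h
    rw [mem_rootsOfUnity'] at h₂ h₃
    obtain ⟨e₂, e₃⟩ := keyT _ _ h₂ h₃ h
    exact ⟨Units.ext e₂, Units.ext e₃⟩
  have hM : ∀ y₂ ∈ rootsOfUnity 6 (ZMod 31), ∀ y₃ ∈ rootsOfUnity 15 (ZMod 31),
      (19 : ZMod 31) * ((y₃ : ZMod 31) - 1) + ((y₂ : ZMod 31) - 1) * y₃ ≠ 12 := by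
    intro y₂ h₂ y₃ h₃
    rw [mem_rootsOfUnity'] at h₂ h₃
    exact keyM _ _ h₂ h₃
  refine sidBody_of_diag_budget (p := 31) (rootsOfUnity 6 (ZMod 31)) (rootsOfUnity 15 (ZMod 31))
    19 12 (by decide) hT hM ε (by linarith) ?_
  rw [card_rootsOfUnity_six_31, card_rootsOfUnity_fifteen_31]
  have := numeric_31 ε hε
  push_cast
  norm_num at this ⊢
  exact this

/-! ## The diagonal family at `p = 241`: the crux body for all `ε ≥ 7` -/

/-- `241` is prime. -/
instance fact_prime_241 : Fact (Nat.Prime 241) := ⟨by norm_num⟩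

set_option maxRecDepth 10000 in
/-- `2` is a primitive `24`-th root of unity mod `241` (`241 ∣ 2²⁴ - 1`). -/
theorem isPrimitiveRoot_two_241 : IsPrimitiveRoot (2 : ZMod 241) 24 := by
  refine IsPrimitiveRoot.mk_of_lt 2 (by norm_num) (by decide) ?_
  intro l h0 hl
  interval_cases l <;> decide

set_option maxRecDepth 10000 in
/-- `17` is a primitive `80`-th root of unity mod `241`. -/
theorem isPrimitiveRoot_seventeen_241 : IsPrimitiveRoot (17 : ZMod 241) 80 := by
  refine IsPrimitiveRoot.mk_of_lt 17 (by norm_num) (by decide) ?_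
  intro l h0 hl
  interval_cases l <;> decide

set_option maxRecDepth 10000 in
/-- The two arithmetic conditions of the diagonal family at `p = 241`, `R₂ = μ₂₄ = ⟨2⟩`,
`R₃ = μ₈₀ = ⟨17⟩`, `c = 217`, `y₀ = 24`, checked by `decide` on the `24 · 80` exponent pairs. -/
theorem diag_key_241 : ∀ i : Fin 24, ∀ j : Fin 80,
    (217 : ZMod 241) * ((17 : ZMod 241) ^ (j : ℕ) - 1) +
        ((2 : ZMod 241) ^ (i : ℕ) - 1) * (17 : ZMod 241) ^ (j : ℕ) ≠ 24 ∧
    ((217 : ZMod 241) * ((17 : ZMod 241) ^ (j : ℕ) - 1) +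
        ((2 : ZMod 241) ^ (i : ℕ) - 1) * (17 : ZMod 241) ^ (j : ℕ) = 0 →
      (2 : ZMod 241) ^ (i : ℕ) = 1 ∧ (17 : ZMod 241) ^ (j : ℕ) = 1) := by
  decide

/-- Transport of `diag_key_241` to `μ₂₄ × μ₈₀ ≤ 𝔽₂₄₁ˣ × 𝔽₂₄₁ˣ`. -/
theorem diag_conditions_241 :
    (∀ y₂ ∈ rootsOfUnity 24 (ZMod 241), ∀ y₃ ∈ rootsOfUnity 80 (ZMod 241),
      (217 : ZMod 241) * ((y₃ : ZMod 241) - 1) + ((y₂ : ZMod 241) - 1) * y₃ = 0 →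
        y₂ = 1 ∧ y₃ = 1) ∧
    (∀ y₂ ∈ rootsOfUnity 24 (ZMod 241), ∀ y₃ ∈ rootsOfUnity 80 (ZMod 241),
      (217 : ZMod 241) * ((y₃ : ZMod 241) - 1) + ((y₂ : ZMod 241) - 1) * y₃ ≠ 24) := by
  have h24 : ∀ y₂ ∈ rootsOfUnity 24 (ZMod 241), ∃ i : Fin 24, (2 : ZMod 241) ^ (i : ℕ) = y₂ := by
    intro y₂ hy
    rw [mem_rootsOfUnity'] at hy
    obtain ⟨i, hi, e⟩ := isPrimitiveRoot_two_241.eq_pow_of_pow_eq_one hy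
    exact ⟨⟨i, hi⟩, e⟩
  have h80 : ∀ y₃ ∈ rootsOfUnity 80 (ZMod 241), ∃ j : Fin 80, (17 : ZMod 241) ^ (j : ℕ) = y₃ := by
    intro y₃ hy
    rw [mem_rootsOfUnity'] at hy
    obtain ⟨j, hj, e⟩ := isPrimitiveRoot_seventeen_241.eq_pow_of_pow_eq_one hy
    exact ⟨⟨j, hj⟩, e⟩
  constructor
  · intro y₂ hy₂ y₃ hy₃ h
    obtain ⟨i, ei⟩ := h24 y₂ hy₂
    obtain ⟨j, ej⟩ := h80 y₃ hy₃
    rw [← ei, ← ej] at h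
    obtain ⟨e₂, e₃⟩ := (diag_key_241 i j).2 h
    refine ⟨Units.ext ?_, Units.ext ?_⟩
    · rw [Units.val_one, ← ei]; exact e₂
    · rw [Units.val_one, ← ej]; exact e₃
  · intro y₂ hy₂ y₃ hy₃
    obtain ⟨i, ei⟩ := h24 y₂ hy₂
    obtain ⟨j, ej⟩ := h80 y₃ hy₃
    rw [← ei, ← ej]
    exact (diag_key_241 i j).1

/-- The numerical inequality at `p = 241`: `242^{1+ε} · 241² < 110592000^{(2+ε)/3}` for `ε ≥ 7`
(`110592000 = 8 · 240³`; after cubing, `242^{24} 241^6 < 110592000^9` and `242³ ≤ 110592000`). -/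
theorem numeric_241 (ε : ℝ) (hε : 7 ≤ ε) :
    (242 : ℝ) ^ (1 + ε) * (241 : ℝ) ^ 2 < (110592000 : ℝ) ^ ((2 + ε) / 3) := by
  have hA : 0 ≤ (242 : ℝ) ^ (1 + ε) * (241 : ℝ) ^ 2 := by positivity
  have hB : 0 ≤ (110592000 : ℝ) ^ ((2 + ε) / 3) := by positivity
  rw [← pow_lt_pow_iff_left₀ hA hB (three_ne_zero)]
  obtain ⟨δ, hδ, rfl⟩ : ∃ δ : ℝ, 0 ≤ δ ∧ ε = 7 + δ := ⟨ε - 7, by linarith, by ring⟩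
  have e1 : ((110592000 : ℝ) ^ ((2 + (7 + δ)) / 3)) ^ 3 =
      (110592000 : ℝ) ^ (9 : ℕ) * (110592000 : ℝ) ^ δ := by
    rw [← Real.rpow_natCast ((110592000 : ℝ) ^ ((2 + (7 + δ)) / 3)) 3,
      ← Real.rpow_mul (by norm_num), ← Real.rpow_natCast (110592000 : ℝ) 9,
      ← Real.rpow_add (by norm_num)]
    congr 1; push_cast; ring
  have e2 : ((242 : ℝ) ^ (1 + (7 + δ)) * (241 : ℝ) ^ 2) ^ 3 =
      (242 : ℝ) ^ (24 : ℕ) * (241 : ℝ) ^ 6 * ((242 : ℝ) ^ (3 : ℕ)) ^ δ := by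
    have hexp : (1 + (7 + δ)) * ((3 : ℕ) : ℝ) = ((24 : ℕ) : ℝ) + ((3 : ℕ) : ℝ) * δ := by
      push_cast; ring
    rw [mul_pow, show ((241 : ℝ) ^ 2) ^ 3 = (241 : ℝ) ^ 6 by norm_num,
      ← Real.rpow_natCast ((242 : ℝ) ^ (1 + (7 + δ))) 3,
      ← Real.rpow_mul (by norm_num), hexp, Real.rpow_add (by norm_num), Real.rpow_natCast,
      Real.rpow_mul (by norm_num), Real.rpow_natCast]
    ring
  rw [e1, e2]
  have h3 : ((242 : ℝ) ^ (3 : ℕ)) ^ δ ≤ (110592000 : ℝ) ^ δ :=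
    Real.rpow_le_rpow (by positivity) (by norm_num) hδ
  have hpos : 0 < ((242 : ℝ) ^ (3 : ℕ)) ^ δ := Real.rpow_pos_of_pos (by positivity) δ
  calc (242 : ℝ) ^ (24 : ℕ) * (241 : ℝ) ^ 6 * ((242 : ℝ) ^ (3 : ℕ)) ^ δ
      < (110592000 : ℝ) ^ (9 : ℕ) * ((242 : ℝ) ^ (3 : ℕ)) ^ δ :=
        mul_lt_mul_of_pos_right (by norm_num) hpos
    _ ≤ (110592000 : ℝ) ^ (9 : ℕ) * (110592000 : ℝ) ^ δ :=
        mul_le_mul_of_nonneg_left h3 (by positivity)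

/-- **The crux body holds at every `ε ≥ 7`**: the diagonal family at `p = 241` with
`R₂ = μ₂₄`, `R₃ = μ₈₀`, `c = 217`, missing unipotent `u₂₄`, volume `110592000 = 8 · 240³`
(exact level-one threshold `ε₀ ≈ 6.0025`; the crude budget needs `ε > 6.003`). -/
theorem sidBody_of_ge_seven (ε : ℝ) (hε : 7 ≤ ε) : SIDBody ε := by
  obtain ⟨hT, hM⟩ := diag_conditions_241
  refine sidBody_of_diag_budget (p := 241) (rootsOfUnity 24 (ZMod 241))
    (rootsOfUnity 80 (ZMod 241)) 217 24 (by decide) hT hM ε (by linarith) ?_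
  rw [isPrimitiveRoot_two_241.card_rootsOfUnity, isPrimitiveRoot_seventeen_241.card_rootsOfUnity]
  have := numeric_241 ε hε
  push_cast
  norm_num at this ⊢
  exact this

/-- **`SubgroupIdentityDesigns` restricted to `ε ≥ 7` is a theorem.** -/
theorem subgroupIdentityDesigns_large_eps : ∀ ε : ℝ, 7 ≤ ε → SIDBody ε :=
  sidBody_of_ge_seven

/-- **The open content of the crux is its small-`ε` regime**:
`SubgroupIdentityDesigns ↔ ∀ ε ∈ (0, 7), SIDBody ε`. -/
theorem subgroupIdentityDesigns_iff_small_eps :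
    Summit.MatrixMultiplication.MatrixMultiplication.Theses.LevelGradedCohnUmans.SubgroupIdentityDesigns
      ↔ ∀ ε : ℝ, 0 < ε → ε < 7 → SIDBody ε := by
  rw [subgroupIdentityDesigns_iff_body]
  refine ⟨fun h ε hε _ => h ε hε, fun h ε hε => ?_⟩
  by_cases h7 : ε < 7
  · exact h ε hε h7
  · exact sidBody_of_ge_seven ε (not_lt.mp h7)

end Summit.MatrixMultiplication.MatrixMultiplication.Theorems.SubgroupIdentityDesigns.Negative

end
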